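/-
Copyright: cell `pub-balaban-gaps` (G2), seat ne6 (row NE7b), `prover-pub-balaban-gaps-ne6-g18-0`. Project licence.
-/
import Summits.QuantumFields.BalabanUV.T4Continuum.Spine.NE7b.CompactFibrePlaquetteMassSUNLimit

/-!
# EQUIPARTITION AT WEAK COUPLING FOR EVERY `N`: `β·⟨Re tr(1−V)⟩_β → (N²−1)∕2` — the mean one-plaquette action under `e^{−β·Re tr(1−V)}dHaar_{SU(N)}` is
# `dim SU(N)∕(2β)` to leading order — from the window constant (every `N`, as hypothesis) and UNCONDITIONALLY for `N = 2` (`→ 3∕2`: V44 §8's `β⟨s⟩_β < 3∕2` is sharp);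
# by a TANGENT-LINE JENSEN inequality `Z_N(β + a) ≥ Z_N(β)·e^{−a⟨s⟩_β}` and the coupling-ratio limit `Z_N(νβ)∕Z_N(β) → ν^{−d∕2}` (row NE7b, node U5c; MODEL, [folklore]; census V49)

Cell `pub-balaban-gaps` (G2 spine census) for the `pub-balaban` T⁴ crux NE7b (`T4WeightBudget.RelWeightBound`; NOT PRINTED, NOT PROVED).  Crux-route work under
`Spine/NE7b/`; imports this lineage's V48 `CompactFibrePlaquetteMassSUNLimit` (the Abelian theorem `(√β)^d·Z_N(β) → C·Γ(d∕2+1)` from the window constant, `Z_N > 0`,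
the `N = 2` window constant by name from seat ne8's `LiveFactorWindowTight`) and through it V38 ∕ V35 (measurability, `0 ≤ Re tr(1−V) ≤ 2N`); Mathlib otherwise
(`Real.add_one_le_exp`, order-topology limits); no `def`, zero `sorry`, nothing of Bałaban's asserted.

THE LOCATED QUESTION (census V49).  V44 §8 (`mean_action_lt_equipartition`, N = 2): `β·∫ s·e^{−βs} dHaar < (3∕2)·∫ e^{−βs} dHaar` at EVERY `β > 0` (`s = Re tr(1−U)`), the
strict form of `f′ > 0` for `f = β^{3∕2}Z_{SU(2)}`; V46: the MEAN action of the reference state is `N`.  QUESTION: what IS `β·⟨s⟩_β` at weak coupling, for every `N`?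
Is V44's `3∕2` the limit, and is the all-`N` answer print's `½·d(𝔤) = (N²−1)∕2` — equipartition over the `N² − 1` real modes of `su(N)` — WITHOUT Weyl, without
differentiating under the Haar integral, without a correlation inequality?

ANSWER ([folklore]):
* §1 `integrable_affine_traceDeficit_boltzmann` (bookkeeping) and **`plaquetteMass_shift_ge`** — the TANGENT-LINE JENSEN INEQUALITY, every `N`, every `β ≥ 0` and shift `a`
  with `β + a ≥ 0`: `Z_N(β + a) ≥ Z_N(β)·exp(−a·⟨s⟩_β)`, `⟨s⟩_β = ∫ s e^{−βs}∕∫ e^{−βs}` (`e^{−a(s − ⟨s⟩)} ≥ 1 − a(s − ⟨s⟩)` integrated against `e^{−βs}dHaar`; the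
  linear term integrates to zero) — Jensen for the tilted state with no tilted measure constructed; **`mul_meanAction_le_freeEnergy`** (`a = −β`): `β·⟨s⟩_β ≤ −log Z_N(β)`
  for every `N`, every `β ≥ 0`.
* §2 **`tendsto_plaquetteMass_ratio_SUN_of_window`** — if `Haar_{SU(N)}{Re tr(1−V) ≤ t}∕(√t)^d → C > 0` then for every `ν > 0`: `Z_N(νβ)∕Z_N(β) → ((√ν)⁻¹)^d`
  (V48's limit at `νβ` and at `β`, `c∕c = 1`); `tendsto_log_plaquetteMass_ratio_SUN_of_window` (`log(Z_N(νβ)∕Z_N(β)) → −(d∕2)·log ν`).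
* §3 **`tendsto_mul_meanAction_SUN_of_window`** — EQUIPARTITION, every `N`, window constant as hypothesis: `β·∫ s e^{−βs} dHaar_{SU(N)} ∕ ∫ e^{−βs} dHaar_{SU(N)} → d∕2`
  as `β → ∞` (in use `d = N² − 1`).  Proof: §1 at shift `(λ−1)β` gives `(λ−1)·β⟨s⟩_β ≥ −log(Z(λβ)∕Z(β)) → (d∕2)·log λ ≥ (d∕2)(1 − 1∕λ)`, so eventually
  `β⟨s⟩_β > a` for any `a < d∕2` (`λ ↓ 1`); §1 at shift `−(1−μ)β` gives `(1−μ)·β⟨s⟩_β ≤ log(Z(μβ)∕Z(β)) → (d∕2)·log μ⁻¹ ≤ (d∕2)(μ⁻¹ − 1)`, so eventually `β⟨s⟩_β < b`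
  for any `b > d∕2` (`μ ↑ 1`); `Real.log_le_sub_one_of_pos` both times — no `log λ∕(λ−1) → 1` needed.
* §4 `N = 2` UNCONDITIONALLY: **`tendsto_mul_meanAction_SU2`** — `β·∫ s e^{−βs} dHaar_{SU(2)} ∕ ∫ e^{−βs} dHaar_{SU(2)} → 3∕2` (ne8's window constant `2∕(3π)`, `d = 3`):
  V44 §8's bound `β⟨s⟩_β < 3∕2` at every `β` is SHARP — `3∕2` is the limit.
* §5 (v1.2, append-only) **`tendsto_meanAction_SUN_of_window`** ∕ **`tendsto_meanAction_SU2`** — the tilted mean action itself VANISHES at weak coupling: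
  `⟨s⟩_β = (β⟨s⟩_β)∕β → (d∕2)·0 = 0` (every `N` from the window constant; `N = 2` unconditionally) — V50's antitone `⟨s⟩_β ≤ N` decreases to `0`, at rate `d∕(2β)`.
* The all-`N` UNCONDITIONAL form (`→ (N²−1)∕2`, the window constant supplied by the tree's exact small-ball asymptotic of `SU(N)` through seat ne8's file 36) is the
  junction J4 `CompactFibrePlaquetteMassSUNConstant`, filed separately once that file is built.

HONEST REMARKS.  (i) MODEL ∕ [folklore]: ONE plaquette variable under Haar; nothing of the interacting measure.  (ii) The window constant is a HYPOTHESIS in §§2–3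
(discharged for `N = 2` in §4 by name; for every `N` by J4); no value for `N ≥ 3`; no rate (the next term `−(N²−1)∕(8Nβ)`-type corrections are not treated); no
monotonicity of `β⟨s⟩_β` claimed.  (iii) (A3) ∕ (A1c) NOT asserted; NC-NE7b-α UNRULED.  BY-NAME EFFECT ON THE WALL: NONE.  NE7b NOT PRINTED ∕ NOT PROVED; spine PROVED
0∕9; rung (B)+1 on ONE finite T⁴ — NOT infinite volume, NOT the mass gap, NOT Clay.
HONEST DEPENDENCY: continuum YM on T⁴ ⇐ BetaPertH ∧ nine spine estimates (0/9 proved); BetaPertH ⇐ (D1) ∧ (D4) ∧ CAP+tail;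
G-an2-4 gates asym, D1 and NE2/3/4.  This file changes none of it.
-/

set_option autoImplicit false

noncomputable section

open MeasureTheory Real Set Filter Topology
open scoped Matrix.Norms.Frobenius
open Literature.MathematicalPhysics.QuantumFieldTheory (haarProbability)
open Summit.QuantumFields.BalabanUV.T4Continuum.NE7b.CompactFibreHalvedActionSUN (measurable_re_trace_one_sub re_trace_one_sub_le_two_mul)
open Summit.QuantumFields.BalabanUV.T4Continuum.NE7b.CompactFibreProfileVolumeSUN (re_trace_one_sub_nonneg)
open Summit.QuantumFields.BalabanUV.T4Continuum.NE7b.CompactFibrePlaquetteMassSUNLimit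
  (plaquetteMass_SUN_pos tendsto_scaled_plaquetteMass_SUN_of_window tendsto_scaled_plaquetteMass_SU2_of_window window_const_mul_Gamma_five_halves_eq)
open Summit.QuantumFields.BalabanUV.T4Continuum.Spine.NE7c.LiveFactorWindowTight (tendsto_window_div_sqrt_cube)

namespace Summit.QuantumFields.BalabanUV.T4Continuum.NE7b.CompactFibreMeanActionSUNLimit

variable {N : ℕ}

/-! ## §1 The tangent-line Jensen inequality `Z_N(β + a) ≥ Z_N(β)·e^{−a⟨s⟩_β}` -/

/-- Bookkeeping: for `γ ≥ 0` and any real `p, q`, `V ↦ (p + q·Re tr(1−V))·e^{−γ·Re tr(1−V)}` is integrable against `Haar_{SU(N)}` (bounded by `|p| + |q|·2N`). [folklore] -/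
theorem integrable_affine_traceDeficit_boltzmann {γ : ℝ} (hγ : 0 ≤ γ) (p q : ℝ) :
    Integrable (fun V : Matrix.specialUnitaryGroup (Fin N) ℂ =>
        (p + q * (Matrix.trace (1 - (V : Matrix (Fin N) (Fin N) ℂ))).re) * Real.exp (-(γ * (Matrix.trace (1 - (V : Matrix (Fin N) (Fin N) ℂ))).re)))
      (haarProbability (Matrix.specialUnitaryGroup (Fin N) ℂ)) := by
  have hmeas : Measurable fun V : Matrix.specialUnitaryGroup (Fin N) ℂ =>
      (p + q * (Matrix.trace (1 - (V : Matrix (Fin N) (Fin N) ℂ))).re) * Real.exp (-(γ * (Matrix.trace (1 - (V : Matrix (Fin N) (Fin N) ℂ))).re)) :=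
    (measurable_const.add (measurable_re_trace_one_sub.const_mul q)).mul (Real.measurable_exp.comp ((measurable_re_trace_one_sub.const_mul γ).neg))
  refine Integrable.of_bound hmeas.aestronglyMeasurable (|p| + |q| * (2 * N)) (ae_of_all _ fun V => ?_)
  have h0 := re_trace_one_sub_nonneg V
  have h2 := re_trace_one_sub_le_two_mul V
  have hexp : Real.exp (-(γ * (Matrix.trace (1 - (V : Matrix (Fin N) (Fin N) ℂ))).re)) ≤ 1 := by
    rw [Real.exp_le_one_iff, neg_nonpos]; exact mul_nonneg hγ h0
  rw [Real.norm_eq_abs, abs_mul, abs_of_pos (Real.exp_pos _)]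
  calc |p + q * (Matrix.trace (1 - (V : Matrix (Fin N) (Fin N) ℂ))).re| * Real.exp (-(γ * (Matrix.trace (1 - (V : Matrix (Fin N) (Fin N) ℂ))).re))
      ≤ (|p| + |q| * (2 * N)) * 1 := by
        refine mul_le_mul ?_ hexp (Real.exp_pos _).le (by positivity)
        calc |p + q * (Matrix.trace (1 - (V : Matrix (Fin N) (Fin N) ℂ))).re| ≤ |p| + |q * (Matrix.trace (1 - (V : Matrix (Fin N) (Fin N) ℂ))).re| := abs_add_le _ _
          _ = |p| + |q| * (Matrix.trace (1 - (V : Matrix (Fin N) (Fin N) ℂ))).re := by rw [abs_mul, abs_of_nonneg h0]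
          _ ≤ |p| + |q| * (2 * N) := by nlinarith [abs_nonneg q]
    _ = |p| + |q| * (2 * N) := mul_one _

/-- **THE TANGENT-LINE JENSEN INEQUALITY, EVERY `N`**: for `β ≥ 0` and any shift `a` with `β + a ≥ 0`,
`∫ e^{−(β+a)·s} dHaar_{SU(N)} ≥ (∫ e^{−β·s} dHaar_{SU(N)})·exp(−a·⟨s⟩_β)`, where `s = Re tr(1−V)` and `⟨s⟩_β = ∫ s e^{−βs} ∕ ∫ e^{−βs}` is the tilted mean
(`e^{−a(s−⟨s⟩)} ≥ 1 − a(s−⟨s⟩)` against `e^{−βs}dHaar`; the linear term integrates to zero). [folklore] -/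
theorem plaquetteMass_shift_ge {β a : ℝ} (hβ : 0 ≤ β) (hβa : 0 ≤ β + a) :
    (∫ V, Real.exp (-(β * (Matrix.trace (1 - (V : Matrix (Fin N) (Fin N) ℂ))).re)) ∂(haarProbability (Matrix.specialUnitaryGroup (Fin N) ℂ))) *
        Real.exp (-(a * ((∫ V, (Matrix.trace (1 - (V : Matrix (Fin N) (Fin N) ℂ))).re * Real.exp (-(β * (Matrix.trace (1 - (V : Matrix (Fin N) (Fin N) ℂ))).re))
            ∂(haarProbability (Matrix.specialUnitaryGroup (Fin N) ℂ))) /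
          ∫ V, Real.exp (-(β * (Matrix.trace (1 - (V : Matrix (Fin N) (Fin N) ℂ))).re)) ∂(haarProbability (Matrix.specialUnitaryGroup (Fin N) ℂ)))))
      ≤ ∫ V, Real.exp (-((β + a) * (Matrix.trace (1 - (V : Matrix (Fin N) (Fin N) ℂ))).re)) ∂(haarProbability (Matrix.specialUnitaryGroup (Fin N) ℂ)) := by
  set μ := haarProbability (Matrix.specialUnitaryGroup (Fin N) ℂ) with hμ
  set s : Matrix.specialUnitaryGroup (Fin N) ℂ → ℝ := fun V => (Matrix.trace (1 - (V : Matrix (Fin N) (Fin N) ℂ))).re with hs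
  set Z : ℝ := ∫ V, Real.exp (-(β * s V)) ∂μ with hZ
  set A : ℝ := ∫ V, s V * Real.exp (-(β * s V)) ∂μ with hA
  have hZpos : 0 < Z := plaquetteMass_SUN_pos (N := N) hβ
  set s₀ : ℝ := A / Z with hs₀
  -- pointwise tangent line: `e^{−βs}·e^{−a s₀}·(1 − a(s − s₀)) ≤ e^{−(β+a)s}`
  have hpt : ∀ V : Matrix.specialUnitaryGroup (Fin N) ℂ,
      Real.exp (-(a * s₀)) * ((1 + a * s₀ + (-a) * s V) * Real.exp (-(β * s V))) ≤ Real.exp (-((β + a) * s V)) := fun V => by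
    have h1 : -(a * (s V - s₀)) + 1 ≤ Real.exp (-(a * (s V - s₀))) := Real.add_one_le_exp _
    have h2 : Real.exp (-((β + a) * s V)) = Real.exp (-(a * s₀)) * (Real.exp (-(a * (s V - s₀))) * Real.exp (-(β * s V))) := by
      rw [← Real.exp_add, ← Real.exp_add]; ring_nf
    rw [h2]
    refine mul_le_mul_of_nonneg_left (mul_le_mul_of_nonneg_right (by linarith) (Real.exp_pos _).le) (Real.exp_pos _).le
  -- integrate
  have hintR : Integrable (fun V => Real.exp (-((β + a) * s V))) μ := by
    have := integrable_affine_traceDeficit_boltzmann (N := N) hβa 1 0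
    simpa [hs] using this
  have hintL : Integrable (fun V => (1 + a * s₀ + (-a) * s V) * Real.exp (-(β * s V))) μ :=
    integrable_affine_traceDeficit_boltzmann (N := N) hβ (1 + a * s₀) (-a)
  have hle := integral_mono (hintL.const_mul (Real.exp (-(a * s₀)))) hintR hpt
  -- the left integral is `e^{−a s₀}·Z` because `∫ s e^{−βs} = s₀·Z`
  have hlin : ∫ V, (1 + a * s₀ + (-a) * s V) * Real.exp (-(β * s V)) ∂μ = Z := by
    have hsplit : ∀ V, (1 + a * s₀ + (-a) * s V) * Real.exp (-(β * s V)) = (1 + a * s₀) * Real.exp (-(β * s V)) + (-a) * (s V * Real.exp (-(β * s V))) :=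
      fun V => by ring
    have hi1 : Integrable (fun V => Real.exp (-(β * s V))) μ := by
      have := integrable_affine_traceDeficit_boltzmann (N := N) hβ 1 0; simpa [hs] using this
    have hi2 : Integrable (fun V => s V * Real.exp (-(β * s V))) μ := by
      have := integrable_affine_traceDeficit_boltzmann (N := N) hβ 0 1; simpa [hs] using this
    simp_rw [hsplit]
    rw [integral_add (hi1.const_mul _) (hi2.const_mul _), integral_const_mul, integral_const_mul, ← hZ, ← hA]
    have hAZ : A = s₀ * Z := by rw [hs₀]; field_simp
    rw [hAZ]; ring
  rw [integral_const_mul, hlin] at hle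
  simpa only [mul_comm] using hle

/-- **`β·⟨s⟩_β ≤ −log Z_N(β)` FOR EVERY `N` AND EVERY `β ≥ 0`**: the tilted mean action times the coupling never exceeds the one-plaquette free energy
(§1 at shift `a = −β`, and `Z_N(0) = 1`); with V39's `−log Z_N(β) ≤ ((N²−1)∕2)·log β + c₁` (`β ≥ 1`) a global `O(log β)` bound on `β⟨s⟩_β`, every `N`. [folklore] -/
theorem mul_meanAction_le_freeEnergy {β : ℝ} (hβ : 0 ≤ β) :
    β * ((∫ V, (Matrix.trace (1 - (V : Matrix (Fin N) (Fin N) ℂ))).re * Real.exp (-(β * (Matrix.trace (1 - (V : Matrix (Fin N) (Fin N) ℂ))).re))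
            ∂(haarProbability (Matrix.specialUnitaryGroup (Fin N) ℂ))) /
          ∫ V, Real.exp (-(β * (Matrix.trace (1 - (V : Matrix (Fin N) (Fin N) ℂ))).re)) ∂(haarProbability (Matrix.specialUnitaryGroup (Fin N) ℂ)))
      ≤ -Real.log (∫ V, Real.exp (-(β * (Matrix.trace (1 - (V : Matrix (Fin N) (Fin N) ℂ))).re)) ∂(haarProbability (Matrix.specialUnitaryGroup (Fin N) ℂ))) := by
  have hZ := plaquetteMass_SUN_pos (N := N) hβ
  have h := plaquetteMass_shift_ge (N := N) (β := β) (a := -β) hβ (by simp)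
  have h0 : ∫ V, Real.exp (-((β + -β) * (Matrix.trace (1 - (V : Matrix (Fin N) (Fin N) ℂ))).re)) ∂(haarProbability (Matrix.specialUnitaryGroup (Fin N) ℂ)) = 1 := by
    simp [probReal_univ]
  rw [h0] at h
  have hlog := Real.log_le_log (mul_pos hZ (Real.exp_pos _)) h
  rw [Real.log_one, Real.log_mul hZ.ne' (Real.exp_pos _).ne', Real.log_exp] at hlog
  linarith

/-! ## §2 The coupling ratio `Z_N(νβ)∕Z_N(β) → ν^{−d∕2}` from the window constant -/

/-- **THE COUPLING RATIO FROM THE WINDOW CONSTANT**: if `Haar_{SU(N)}{Re tr(1−V) ≤ t}∕(√t)^d → C > 0` then for every `ν > 0`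
`∫ e^{−νβ·Re tr(1−V)} dHaar_{SU(N)} ∕ ∫ e^{−β·Re tr(1−V)} dHaar_{SU(N)} → ((√ν)⁻¹)^d` as `β → ∞`. [folklore] -/
theorem tendsto_plaquetteMass_ratio_SUN_of_window {d : ℕ} {C : ℝ} (hCpos : 0 < C)
    (hC : Tendsto (fun t : ℝ => (haarProbability (Matrix.specialUnitaryGroup (Fin N) ℂ)).real
        {V : Matrix.specialUnitaryGroup (Fin N) ℂ | (Matrix.trace (1 - (V : Matrix (Fin N) (Fin N) ℂ))).re ≤ t} / Real.sqrt t ^ d) (𝓝[>] 0) (𝓝 C))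
    {ν : ℝ} (hν : 0 < ν) :
    Tendsto (fun β : ℝ =>
        (∫ V, Real.exp (-(ν * β * (Matrix.trace (1 - (V : Matrix (Fin N) (Fin N) ℂ))).re)) ∂(haarProbability (Matrix.specialUnitaryGroup (Fin N) ℂ))) /
          ∫ V, Real.exp (-(β * (Matrix.trace (1 - (V : Matrix (Fin N) (Fin N) ℂ))).re)) ∂(haarProbability (Matrix.specialUnitaryGroup (Fin N) ℂ)))
      atTop (𝓝 ((Real.sqrt ν)⁻¹ ^ d)) := by
  have hg := tendsto_scaled_plaquetteMass_SUN_of_window (N := N) hC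
  set c : ℝ := C * Real.Gamma ((d : ℝ) / 2 + 1) with hc
  have hcpos : 0 < c := mul_pos hCpos (Real.Gamma_pos_of_pos (by positivity))
  set Z : ℝ → ℝ := fun β => ∫ V, Real.exp (-(β * (Matrix.trace (1 - (V : Matrix (Fin N) (Fin N) ℂ))).re))
    ∂(haarProbability (Matrix.specialUnitaryGroup (Fin N) ℂ)) with hZ
  have hgν : Tendsto (fun β : ℝ => Real.sqrt (ν * β) ^ d * Z (ν * β)) atTop (𝓝 c) := hg.comp (tendsto_id.const_mul_atTop hν)
  have hquot : Tendsto (fun β : ℝ => Real.sqrt (ν * β) ^ d * Z (ν * β) / (Real.sqrt β ^ d * Z β)) atTop (𝓝 1) := by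
    have := hgν.div hg hcpos.ne'
    rwa [div_self hcpos.ne'] at this
  have hlim := hquot.mul_const ((Real.sqrt ν)⁻¹ ^ d)
  rw [one_mul] at hlim
  refine hlim.congr' ?_
  filter_upwards [eventually_gt_atTop (0 : ℝ)] with β hβ
  have hsβ : 0 < Real.sqrt β := Real.sqrt_pos.2 hβ
  have hsν : 0 < Real.sqrt ν := Real.sqrt_pos.2 hν
  have hZβ : 0 < Z β := plaquetteMass_SUN_pos (N := N) hβ.le
  have hνβ : Real.sqrt (ν * β) = Real.sqrt ν * Real.sqrt β := Real.sqrt_mul hν.le β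
  simp only [hZ]
  rw [hνβ, mul_pow, inv_pow]
  field_simp

/-- `log` of the coupling ratio: `log(Z_N(νβ)∕Z_N(β)) → −(d∕2)·log ν`. [folklore] -/
theorem tendsto_log_plaquetteMass_ratio_SUN_of_window {d : ℕ} {C : ℝ} (hCpos : 0 < C)
    (hC : Tendsto (fun t : ℝ => (haarProbability (Matrix.specialUnitaryGroup (Fin N) ℂ)).real
        {V : Matrix.specialUnitaryGroup (Fin N) ℂ | (Matrix.trace (1 - (V : Matrix (Fin N) (Fin N) ℂ))).re ≤ t} / Real.sqrt t ^ d) (𝓝[>] 0) (𝓝 C))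
    {ν : ℝ} (hν : 0 < ν) :
    Tendsto (fun β : ℝ => Real.log
        ((∫ V, Real.exp (-(ν * β * (Matrix.trace (1 - (V : Matrix (Fin N) (Fin N) ℂ))).re)) ∂(haarProbability (Matrix.specialUnitaryGroup (Fin N) ℂ))) /
          ∫ V, Real.exp (-(β * (Matrix.trace (1 - (V : Matrix (Fin N) (Fin N) ℂ))).re)) ∂(haarProbability (Matrix.specialUnitaryGroup (Fin N) ℂ))))
      atTop (𝓝 (-((d : ℝ) / 2) * Real.log ν)) := by
  have hsν : 0 < Real.sqrt ν := Real.sqrt_pos.2 hν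
  have hL : 0 < (Real.sqrt ν)⁻¹ ^ d := pow_pos (inv_pos.2 hsν) d
  have h := (Real.continuousAt_log hL.ne').tendsto.comp (tendsto_plaquetteMass_ratio_SUN_of_window (N := N) hCpos hC hν)
  rw [Real.log_pow, Real.log_inv, Real.log_sqrt hν.le] at h
  have e : -((d : ℝ) / 2) * Real.log ν = (d : ℝ) * -(Real.log ν / 2) := by ring
  rw [e]
  exact h

/-! ## §3 Equipartition for every `N` from the window constant -/

/-- **EQUIPARTITION AT WEAK COUPLING, EVERY `N`, FROM THE WINDOW CONSTANT**: if `Haar_{SU(N)}{Re tr(1−V) ≤ t}∕(√t)^d → C > 0` then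
`β·∫ Re tr(1−V)·e^{−β·Re tr(1−V)} dHaar_{SU(N)} ∕ ∫ e^{−β·Re tr(1−V)} dHaar_{SU(N)} → d∕2` as `β → ∞` (in use `d = N² − 1 = dim SU(N)`: the mean plaquette action is
`dim SU(N)∕(2β)` to leading order). [folklore] -/
theorem tendsto_mul_meanAction_SUN_of_window {d : ℕ} {C : ℝ} (hCpos : 0 < C)
    (hC : Tendsto (fun t : ℝ => (haarProbability (Matrix.specialUnitaryGroup (Fin N) ℂ)).real
        {V : Matrix.specialUnitaryGroup (Fin N) ℂ | (Matrix.trace (1 - (V : Matrix (Fin N) (Fin N) ℂ))).re ≤ t} / Real.sqrt t ^ d) (𝓝[>] 0) (𝓝 C)) :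
    Tendsto (fun β : ℝ => β *
        ((∫ V, (Matrix.trace (1 - (V : Matrix (Fin N) (Fin N) ℂ))).re * Real.exp (-(β * (Matrix.trace (1 - (V : Matrix (Fin N) (Fin N) ℂ))).re))
            ∂(haarProbability (Matrix.specialUnitaryGroup (Fin N) ℂ))) /
          ∫ V, Real.exp (-(β * (Matrix.trace (1 - (V : Matrix (Fin N) (Fin N) ℂ))).re)) ∂(haarProbability (Matrix.specialUnitaryGroup (Fin N) ℂ))))
      atTop (𝓝 ((d : ℝ) / 2)) := by
  set μ := haarProbability (Matrix.specialUnitaryGroup (Fin N) ℂ) with hμ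
  set s : Matrix.specialUnitaryGroup (Fin N) ℂ → ℝ := fun V => (Matrix.trace (1 - (V : Matrix (Fin N) (Fin N) ℂ))).re with hs
  set Z : ℝ → ℝ := fun β => ∫ V, Real.exp (-(β * s V)) ∂μ with hZ
  set A : ℝ → ℝ := fun β => ∫ V, s V * Real.exp (-(β * s V)) ∂μ with hA
  -- the quantity `g(β) = β·⟨s⟩_β`
  set g : ℝ → ℝ := fun β => β * (A β / Z β) with hg
  have hD0 : (0 : ℝ) ≤ (d : ℝ) / 2 := by positivity
  -- §1 in the two directions: for `β > 0`, `λ > 0`: `(λ − 1)·g(β) ≥ −log(Z(λβ)∕Z(β))`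
  have hkey : ∀ (l β : ℝ), 0 < l → 0 < β → -Real.log (Z (l * β) / Z β) ≤ (l - 1) * g β := fun l β hl hβ => by
    have hZβ : 0 < Z β := plaquetteMass_SUN_pos (N := N) hβ.le
    have hZl : 0 < Z (l * β) := plaquetteMass_SUN_pos (N := N) (mul_pos hl hβ).le
    have h := plaquetteMass_shift_ge (N := N) (β := β) (a := (l - 1) * β) hβ.le (by nlinarith)
    have hrew : β + (l - 1) * β = l * β := by ring
    rw [hrew] at h
    -- `Z β · exp(−(l−1)β⟨s⟩) ≤ Z(lβ)` ⟹ `−(l−1)·g ≤ log(Z(lβ)/Z β)`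
    have h2 : Real.exp (-((l - 1) * β * (A β / Z β))) ≤ Z (l * β) / Z β := by
      rw [le_div_iff₀ hZβ, mul_comm]; exact h
    have h3 := Real.log_le_log (Real.exp_pos _) h2
    rw [Real.log_exp] at h3
    simp only [hg]
    linarith
  refine tendsto_order.2 ⟨fun a ha => ?_, fun b hb => ?_⟩
  · -- LOWER: eventually `a < g β`, via `λ > 1` with `(d/2)/λ > a`
    obtain ⟨l, hl1, hla⟩ : ∃ l : ℝ, 1 < l ∧ a < (d : ℝ) / 2 / l := by
      rcases le_or_gt a 0 with ha0 | ha0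
      · rcases eq_or_lt_of_le hD0 with hD | hD
        · exact ⟨2, one_lt_two, by rw [← hD]; linarith⟩
        · exact ⟨2, one_lt_two, lt_of_le_of_lt ha0 (by positivity)⟩
      · refine ⟨((d : ℝ) / 2 / a + 1) / 2, ?_, ?_⟩
        · have : 1 < (d : ℝ) / 2 / a := by rw [lt_div_iff₀ ha0]; linarith
          linarith
        · have hq : 1 < (d : ℝ) / 2 / a := by rw [lt_div_iff₀ ha0]; linarith
          rw [lt_div_iff₀ (by linarith)]
          have : a * ((d : ℝ) / 2 / a) = (d : ℝ) / 2 := by field_simp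
          nlinarith
    have hl0 : 0 < l := by linarith
    -- `−log(Z(lβ)/Z β)/(l−1) → (d/2)·log l/(l−1) ≥ (d/2)/l > a`... we use `log l ≥ 1 − 1/l`
    have hlim := ((tendsto_log_plaquetteMass_ratio_SUN_of_window (N := N) hCpos hC hl0).neg).div_const (l - 1)
    have htarget : a < -(-((d : ℝ) / 2) * Real.log l) / (l - 1) := by
      have hlog : 1 - 1 / l ≤ Real.log l := by
        have := Real.log_le_sub_one_of_pos (inv_pos.2 hl0)
        rw [Real.log_inv] at this
        have h' : 1 - 1 / l = -(l⁻¹ - 1) := by rw [one_div]; ring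
        linarith
      rw [lt_div_iff₀ (by linarith)]
      have h1 : a * (l - 1) < (d : ℝ) / 2 / l * (l - 1) := mul_lt_mul_of_pos_right hla (by linarith)
      have h2 : (d : ℝ) / 2 / l * (l - 1) = (d : ℝ) / 2 * (1 - 1 / l) := by field_simp
      nlinarith
    filter_upwards [hlim.eventually_const_lt htarget, eventually_gt_atTop (0 : ℝ)] with β hβ hβ0
    have hk := hkey l β hl0 hβ0
    have : -Real.log (Z (l * β) / Z β) / (l - 1) ≤ g β := by rw [div_le_iff₀ (by linarith)]; linarith
    exact lt_of_lt_of_le hβ this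
  · -- UPPER: eventually `g β < b`, via `m < 1` with `(d/2)/m < b`
    have hb0 : 0 < b := lt_of_le_of_lt hD0 hb
    obtain ⟨m, hm0, hm1, hmb⟩ : ∃ m : ℝ, 0 < m ∧ m < 1 ∧ (d : ℝ) / 2 / m < b := by
      refine ⟨((d : ℝ) / 2 / b + 1) / 2, by positivity, ?_, ?_⟩
      · have : (d : ℝ) / 2 / b < 1 := by rw [div_lt_iff₀ hb0]; linarith
        linarith
      · have hq : (d : ℝ) / 2 / b < 1 := by rw [div_lt_iff₀ hb0]; linarith
        rw [div_lt_iff₀ (by positivity)]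
        have : b * ((d : ℝ) / 2 / b) = (d : ℝ) / 2 := by field_simp
        nlinarith
    -- §1 at shift `−(1−m)β`: `(m − 1)·g β ≥ −log(Z(mβ)/Z β)`, i.e. `(1−m) g β ≤ log(Z(mβ)/Z β) → (d/2)·log m⁻¹ ≤ (d/2)(m⁻¹ − 1)`
    have hlim := (tendsto_log_plaquetteMass_ratio_SUN_of_window (N := N) hCpos hC hm0).div_const (1 - m)
    have htarget : -((d : ℝ) / 2) * Real.log m / (1 - m) < b := by
      have hlog : -Real.log m ≤ m⁻¹ - 1 := by
        have := Real.log_le_sub_one_of_pos (inv_pos.2 hm0)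
        rwa [Real.log_inv] at this
      rw [div_lt_iff₀ (by linarith)]
      have h1 : (d : ℝ) / 2 / m * (1 - m) < b * (1 - m) := mul_lt_mul_of_pos_right hmb (by linarith)
      have h2 : (d : ℝ) / 2 / m * (1 - m) = (d : ℝ) / 2 * (m⁻¹ - 1) := by field_simp
      nlinarith
    filter_upwards [hlim.eventually_lt_const htarget, eventually_gt_atTop (0 : ℝ)] with β hβ hβ0
    have hk := hkey m β hm0 hβ0
    have : g β ≤ Real.log (Z (m * β) / Z β) / (1 - m) := by rw [le_div_iff₀ (by linarith)]; linarith
    exact lt_of_le_of_lt this hβ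

/-! ## §4 `N = 2` unconditionally: `β·⟨s⟩_β → 3∕2` — V44 §8's bound is sharp -/

/-- **EQUIPARTITION FOR `SU(2)`, UNCONDITIONALLY**: `β·∫ Re tr(1−U)·e^{−β·Re tr(1−U)} dHaar_{SU(2)} ∕ ∫ e^{−β·Re tr(1−U)} dHaar_{SU(2)} → 3∕2` as `β → ∞`
(ne8's window constant `2∕(3π)`, `d = 3`).  V44 §8 `mean_action_lt_equipartition` says `β⟨s⟩_β < 3∕2` at EVERY `β > 0`; this says the bound is SHARP: `3∕2` is the
limit. [folklore] -/
theorem tendsto_mul_meanAction_SU2 :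
    Tendsto (fun β : ℝ => β *
        ((∫ U, (Matrix.trace (1 - (U : Matrix (Fin 2) (Fin 2) ℂ))).re * Real.exp (-(β * (Matrix.trace (1 - (U : Matrix (Fin 2) (Fin 2) ℂ))).re))
            ∂(haarProbability (Matrix.specialUnitaryGroup (Fin 2) ℂ))) /
          ∫ U, Real.exp (-(β * (Matrix.trace (1 - (U : Matrix (Fin 2) (Fin 2) ℂ))).re)) ∂(haarProbability (Matrix.specialUnitaryGroup (Fin 2) ℂ))))
      atTop (𝓝 (3 / 2)) := by
  have h := tendsto_mul_meanAction_SUN_of_window (N := 2) (d := 3) (by positivity) tendsto_window_div_sqrt_cube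
  have e : ((3 : ℕ) : ℝ) / 2 = 3 / 2 := by norm_num
  rw [e] at h
  exact h

/-- **THE `SU(2)` COUPLING RATIO, UNCONDITIONALLY**: `Z_{SU(2)}(νβ)∕Z_{SU(2)}(β) → ((√ν)⁻¹)³` as `β → ∞`, every `ν > 0` (J3's `Z((1−δ)β) < (1−δ)^{−3∕2}Z(β)` at every
`β` has the exact rate: the constant `1` is attained in the limit). [folklore] -/
theorem tendsto_plaquetteMass_ratio_SU2 {ν : ℝ} (hν : 0 < ν) :
    Tendsto (fun β : ℝ =>
        (∫ U, Real.exp (-(ν * β * (Matrix.trace (1 - (U : Matrix (Fin 2) (Fin 2) ℂ))).re)) ∂(haarProbability (Matrix.specialUnitaryGroup (Fin 2) ℂ))) /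
          ∫ U, Real.exp (-(β * (Matrix.trace (1 - (U : Matrix (Fin 2) (Fin 2) ℂ))).re)) ∂(haarProbability (Matrix.specialUnitaryGroup (Fin 2) ℂ)))
      atTop (𝓝 ((Real.sqrt ν)⁻¹ ^ 3)) :=
  tendsto_plaquetteMass_ratio_SUN_of_window (N := 2) (d := 3) (by positivity) tendsto_window_div_sqrt_cube hν

/-! ## §5 (v1.2) The tilted mean action vanishes at weak coupling -/

/-- **THE TILTED MEAN ACTION VANISHES AT WEAK COUPLING, EVERY `N`, FROM THE WINDOW CONSTANT**: if `Haar_{SU(N)}{Re tr(1−V) ≤ t}∕(√t)^d → C > 0` then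
`∫ Re tr(1−V)·e^{−β·Re tr(1−V)} dHaar_{SU(N)} ∕ ∫ e^{−β·Re tr(1−V)} dHaar_{SU(N)} → 0` as `β → ∞` (`= (β⟨s⟩_β)·β⁻¹` with `β⟨s⟩_β → d∕2` and `β⁻¹ → 0`). [folklore] -/
theorem tendsto_meanAction_SUN_of_window {d : ℕ} {C : ℝ} (hCpos : 0 < C)
    (hC : Tendsto (fun t : ℝ => (haarProbability (Matrix.specialUnitaryGroup (Fin N) ℂ)).real
        {V : Matrix.specialUnitaryGroup (Fin N) ℂ | (Matrix.trace (1 - (V : Matrix (Fin N) (Fin N) ℂ))).re ≤ t} / Real.sqrt t ^ d) (𝓝[>] 0) (𝓝 C)) :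
    Tendsto (fun β : ℝ =>
        (∫ V, (Matrix.trace (1 - (V : Matrix (Fin N) (Fin N) ℂ))).re * Real.exp (-(β * (Matrix.trace (1 - (V : Matrix (Fin N) (Fin N) ℂ))).re))
            ∂(haarProbability (Matrix.specialUnitaryGroup (Fin N) ℂ))) /
          ∫ V, Real.exp (-(β * (Matrix.trace (1 - (V : Matrix (Fin N) (Fin N) ℂ))).re)) ∂(haarProbability (Matrix.specialUnitaryGroup (Fin N) ℂ)))
      atTop (𝓝 0) := by
  have h := (tendsto_mul_meanAction_SUN_of_window (N := N) hCpos hC).mul tendsto_inv_atTop_zero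
  rw [mul_zero] at h
  refine h.congr' ?_
  filter_upwards [eventually_gt_atTop (0 : ℝ)] with β hβ
  field_simp

/-- **`N = 2` UNCONDITIONALLY**: `∫ Re tr(1−U)·e^{−β·Re tr(1−U)} dHaar_{SU(2)} ∕ ∫ e^{−β·Re tr(1−U)} dHaar_{SU(2)} → 0` as `β → ∞` (V50: from `2` at `β = 0`, antitone). [folklore] -/
theorem tendsto_meanAction_SU2 :
    Tendsto (fun β : ℝ =>
        (∫ U, (Matrix.trace (1 - (U : Matrix (Fin 2) (Fin 2) ℂ))).re * Real.exp (-(β * (Matrix.trace (1 - (U : Matrix (Fin 2) (Fin 2) ℂ))).re))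
            ∂(haarProbability (Matrix.specialUnitaryGroup (Fin 2) ℂ))) /
          ∫ U, Real.exp (-(β * (Matrix.trace (1 - (U : Matrix (Fin 2) (Fin 2) ℂ))).re)) ∂(haarProbability (Matrix.specialUnitaryGroup (Fin 2) ℂ)))
      atTop (𝓝 0) :=
  tendsto_meanAction_SUN_of_window (N := 2) (d := 3) (by positivity) tendsto_window_div_sqrt_cube

end Summit.QuantumFields.BalabanUV.T4Continuum.NE7b.CompactFibreMeanActionSUNLimit

end
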